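import Summits.HodgeConjecture.HodgeConjecture.Theorems.R90S10U2SquareIntegrableOfJacquetDecay      -- ★ p863417 brick (A): `isSquareIntegrable_of_jacquet_decays_two` (Casselman «⇐» on `U(Φ₂)(L⁺_v)`)
import Summits.HodgeConjecture.HodgeConjecture.Theorems.R90S10U2SteinbergJacquetLabel                -- ★-cand brick (B): `exists_normalizedJacquet_equiv_chiH2_of_ne_ofChar` (`r_{B₂}(St(ξ₂)) ≅ χH₂`)
import Summits.HodgeConjecture.HodgeConjecture.Theorems.R90S4PrincipalSeriesConstituentAdmissible    -- ★ `R90.S4.isAdmissible_of_isConstituentOf_cmPrincipalSeries`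
import Summits.HodgeConjecture.HodgeConjecture.Theorems.F0P3cStCharTSPrincipalSeriesUnitary          -- ★ `norm_apply_normOneUnits_eq_one` (continuous characters of the compact `E¹_v` are unitary)
import Summits.HodgeConjecture.HodgeConjecture.Theorems.F0P3bHPrincipalSeriesJHOfUTwo               -- ★ `isOpen_ker_of_continuous_unitsComplex`
import Literature.NumberTheory.Rogawski1990.XiLocalCharacter                                            -- ★ `OneDimAutRepH.xiLocalChar`, `xiLocalChar_apply_eq`
import Literature.NumberTheory.Rogawski1990.U3PrincipalSeriesReducibility                            -- ★ `IrrClass.IsSquareIntegrable`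
import Summits.HodgeConjecture.HodgeConjecture.Theorems.K2E1TraceFormulaBetaDefs                       -- ★ `Pl` (the socket's place token) — statement tokens of (St₂-L²) as in ★ p863145
import HarnessLib

/-!
# R90-TF ∕ S10 — (St₂-L²): THE STEINBERG CONSTITUENT OF `i(χH₂)` ON `U(Φ₂)(L⁺_v) ≅ U(1,1)` IS SQUARE-INTEGRABLE MODULO THE CENTRE at a non-split place
# — the named input of ★ p863145 `steinbergFactorSt_of_sqInt` (socket A1′), DISCHARGED (brick (C) = (A) ∘ (B))
# (`Theorems/R90S10U2SteinbergSquareIntegrable.lean`; ns `Summit.HodgeConjecture.HodgeConjecture.R90.S10`; lane `--supports stmt-HodgeConjecture-24833 --as helper`)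

Cell `pub/hodgecm-mathlib`, R90-TF SLAB section S10, seat R90-C138-p04 (g0), card A1′ PHASE 2 brick (C).  THEOREMS ONLY — sorry-free, no `def`, no instance, no notation,
no named fact; ★-only imports.

THE MATHEMATICS ([Rogawski1990, §12.1 case (1) pp. 171–172, §12.2 p. 173 «`St_H(ξ)` … square-integrable»]; [Casselman1995, Thm. 4.4.6]).  At a finite place `v` of `L⁺`
NON-SPLIT in `L`, a constituent `c ≠ ⟦ℂ_{ξ₂}⟧` of `i(χH₂)` (`χH₂ = (η̃_v‖·‖^{1/2}, ψ_v)`, `ξ₂ = ξ_v ∘ inl = (η_vψ_v)∘det₂`) is the Steinberg representation `St(ξ₂)`: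
by ★ brick (B) its normalised Jacquet module is the character `χH₂`, which DECAYS on the contracting torus — `|χH₂(d(α, (σα)⁻¹))| = |η_v(α∕σα)|·‖α‖^{1/2}·|ψ_v(det)| =
‖α‖^{1/2} < 1` for `‖α‖ < 1`, the characters `η_v, ψ_v` of the COMPACT `E¹_v` being unitary (★ `norm_apply_normOneUnits_eq_one`) (§1 `norm_chiH2_lt_one`); `c` is
admissible (★ `R90.S4.isAdmissible_of_isConstituentOf_cmPrincipalSeries`); so ★ brick (A) (Casselman «⇐» for `U(Φ₂)`, any Haar measure on `U(Φ₂)_v ⧸ Z`, here Mathlib's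
`Measure.haar` on the Borel quotient) makes `c` square-integrable modulo the centre.  §2 `st₂_sqInt` states this in the EXACT text of the hypothesis `hSt₂` of ★
`steinbergFactorSt_of_sqInt` (the `(cmDatum L 2 Φ₂).Local v` spelling; the junction to the `↥(unitaryGroupOfForm … (cmLocalForm L 2 v))` spelling of (A)∕(B) is
definitional, ★ `cmDatum_Local_eq`), so brick (D) `steinbergFactorSt := steinbergFactorSt_of_sqInt st₂_sqInt` pays A1′ unconditionally.
HONEST LABEL: helper ★ pays no socket until the Lines edition names it; HC_CM is proved only modulo the 7 printed citations (2 remaining named inputs: hLiu418 =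
`stmt-HodgeConjecture-24832`, h413 = `stmt-HodgeConjecture-24833`) until rung 0 closes; REL ≠ ★ ≠ BUILT; count-neutral.

## References
* [Rogawski1990] J. D. Rogawski, *Automorphic Representations of Unitary Groups in Three Variables*, Ann. of Math. Stud. 123 (1990), §12.1 pp. 171–172; §12.2 p. 173.
* [Casselman1995] W. Casselman, *Introduction to the theory of admissible representations of `p`-adic reductive groups* (draft 1995), Thm. 4.4.6 p. 45; Prop. 7.1.3 p. 67.
-/

set_option autoImplicit false
set_option linter.dupNamespace false

noncomputable section

open NumberField IsDedekindDomain MeasureTheory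
open scoped Matrix MatrixGroups NNReal
open Literature.NumberTheory.Rogawski1990 Literature.NumberTheory.Automorphic Literature.NumberTheory.Automorphic.UnitaryGroup
open Literature.NumberTheory.GaloisRepresentations

namespace Summit.HodgeConjecture.HodgeConjecture.R90.S10

open Summit.HodgeConjecture.HodgeConjecture.Cruxes.H413
open Summit.HodgeConjecture.HodgeConjecture.Cruxes.H413.K2E1TraceFormulaBeta

/-! ## §1 `χH₂` decays on the contracting torus -/

/-- **`|χH₂(t)| = ‖t₀₀‖^{1/2} < 1` for `t ∈ T₂(L⁺_v)` with `‖t₀₀‖ < 1`** (`v` non-split): `χH₂(t) = η_v(quotConj t₀₀)·‖t₀₀‖^{1/2}·ψ_v(det t)` (★ `torusCharPair_apply`) with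
`|η_v| = |ψ_v| = 1` on the compact `E¹_v` (★ `norm_apply_normOneUnits_eq_one`) and `|‖t₀₀‖^{1/2}| = √‖t₀₀‖` (★ `coe_halfModulusChar_apply`).
[cite: Rogawski1990, §12.2 p. 173] [cite: Casselman1995, Prop. 7.1.3 p. 67] -/
theorem norm_chiH2_lt_one (L : Type) [Field L] [NumberField L] [IsCMField L] (v : HeightOneSpectrum (𝓞 ↥(maximalRealSubfield L)))
    (hns : ∀ w : PlacesOver L v, IsCMField.complexConj L • w.1 = w.1) (ξ : OneDimAutRepH L)
    (t : ↥(torusU (conjLocal L (IsCMField.complexConj L) v) (cmLocalForm L 2 v)))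
    (ht : unitModulusChar (LocalRing L v) (torusEntry (conjLocal L (IsCMField.complexConj L) v) (cmLocalForm L 2 v) 0 t) < 1) :
    ‖((torusCharPair (conjLocal L (IsCMField.complexConj L) v) (cmLocalForm L 2 v) (cmLocalForm_eq_over L 2 v) 0
        ((torusLocalComponent L (IsCMField.complexConj L) v ξ.η).comp
            (quotConj (conjLocal L (IsCMField.complexConj L) v) (conjLocal_conjLocal_cm L v)) *
          halfModulusChar (UnitaryGroup.LocalRing L v))
        (torusLocalComponent L (IsCMField.complexConj L) v ξ.ψ) t : ℂˣ) : ℂ)‖ < 1 := by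
  have hη := F0P3cStCharTSPrincipalSeriesUnitary.norm_apply_normOneUnits_eq_one L v hns (torusLocalComponent L (IsCMField.complexConj L) v ξ.η)
    (continuous_torusLocalComponent L (IsCMField.complexConj L) (v := v) ξ.η)
  have hψ := F0P3cStCharTSPrincipalSeriesUnitary.norm_apply_normOneUnits_eq_one L v hns (torusLocalComponent L (IsCMField.complexConj L) v ξ.ψ)
    (continuous_torusLocalComponent L (IsCMField.complexConj L) (v := v) ξ.ψ)
  rw [torusCharPair_apply, MonoidHom.mul_apply, MonoidHom.comp_apply, Units.val_mul, Units.val_mul, norm_mul, norm_mul, hη, hψ, one_mul, mul_one,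
    coe_halfModulusChar_apply, Complex.norm_real, Real.norm_of_nonneg (NNReal.coe_nonneg _), ← NNReal.coe_one, NNReal.coe_lt_coe]
  have h := NNReal.sqrt_lt_sqrt.2 ht
  rwa [NNReal.sqrt_one] at h

/-! ## §2 (St₂-L²) — the hypothesis `hSt₂` of ★ `steinbergFactorSt_of_sqInt`, verbatim, as a theorem -/

set_option synthInstance.maxHeartbeats 400000 in
set_option maxHeartbeats 4000000 in  -- the two carrier spellings of `U(Φ₂)_v` (`(cmDatum …).Local v` of the socket vs `↥(unitaryGroupOfForm …)` of (A)∕(B)) meet once each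
/-- **(St₂-L²) — THE STEINBERG REPRESENTATION `St(ξ₂)` OF `U(1,1)` IS SQUARE-INTEGRABLE MODULO THE CENTRE.**  At every finite place `v` NON-SPLIT in `L`, for every proof `hξ₂`
that `ξ₂ = ξ_v ∘ inl` has open kernel, every constituent `c ≠ ⟦ℂ_{ξ₂}⟧` of `i(χH₂) = cmPrincipalSeries L 2 v (η̃_v‖·‖^{1/2}, ψ_v)` is square-integrable modulo the centre for some
(indeed Mathlib's) Haar measure on the Borel quotient `U(Φ₂)_v ⧸ Z` — the text of the hypothesis `hSt₂` of ★ `steinbergFactorSt_of_sqInt` TOKEN FOR TOKEN (brick (A) ★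
`isSquareIntegrable_of_jacquet_decays_two` ∘ brick (B) ★ `exists_normalizedJacquet_equiv_chiH2_of_ne_ofChar` ∘ §1). [cite: Rogawski1990, §12.1 pp. 171–172; §12.2 p. 173]
[cite: Casselman1995, Thm. 4.4.6 p. 45] -/
theorem st₂_sqInt : ∀ (L : Type) [Field L] [NumberField L] [IsCMField L] (v : Pl L) (ξ : OneDimAutRepH L),
      (∀ w : PlacesOver L v, IsCMField.complexConj L • w.1 = w.1) →
      ∀ (hξ₂ : IsOpen (((((ξ.xiLocalChar v).comp (MonoidHom.inl ((UnitaryGroup.cmDatum L 2 (Matrix.of fun i j : Fin 2 => if i.val + j.val + 1 = 2 then (1 : L) else 0)).Local v)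
          ((UnitaryGroup.cmDatum L 1 (Matrix.of fun i j : Fin 1 => if i.val + j.val + 1 = 1 then (1 : L) else 0)).Local v))).ker :
          Subgroup ((UnitaryGroup.cmDatum L 2 (Matrix.of fun i j : Fin 2 => if i.val + j.val + 1 = 2 then (1 : L) else 0)).Local v)) :
          Set ((UnitaryGroup.cmDatum L 2 (Matrix.of fun i j : Fin 2 => if i.val + j.val + 1 = 2 then (1 : L) else 0)).Local v))))
        (c : IrrClass ((UnitaryGroup.cmDatum L 2 (Matrix.of fun i j : Fin 2 => if i.val + j.val + 1 = 2 then (1 : L) else 0)).Local v)),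
        c.IsConstituentOf (haveI := locallyCompactSpace_cmBorelU L 2 v; cmPrincipalSeries L 2 v
          (torusCharPair (conjLocal L (IsCMField.complexConj L) v) (cmLocalForm L 2 v) (cmLocalForm_eq_over L 2 v) 0
            ((torusLocalComponent L (IsCMField.complexConj L) v ξ.η).comp
                (quotConj (conjLocal L (IsCMField.complexConj L) v) (conjLocal_conjLocal_cm L v)) *
              halfModulusChar (UnitaryGroup.LocalRing L v))
            (torusLocalComponent L (IsCMField.complexConj L) v ξ.ψ))) →
        c ≠ IrrClass.mk (SmoothIrrep.ofChar ((ξ.xiLocalChar v).comp (MonoidHom.inl ((UnitaryGroup.cmDatum L 2 (Matrix.of fun i j : Fin 2 => if i.val + j.val + 1 = 2 then (1 : L) else 0)).Local v)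
          ((UnitaryGroup.cmDatum L 1 (Matrix.of fun i j : Fin 1 => if i.val + j.val + 1 = 1 then (1 : L) else 0)).Local v))) hξ₂) →
        letI : MeasurableSpace ((UnitaryGroup.cmDatum L 2 (Matrix.of fun i j : Fin 2 => if i.val + j.val + 1 = 2 then (1 : L) else 0)).Local v ⧸ Subgroup.center ((UnitaryGroup.cmDatum L 2 (Matrix.of fun i j : Fin 2 => if i.val + j.val + 1 = 2 then (1 : L) else 0)).Local v)) := borel _
        ∃ μZ : Measure ((UnitaryGroup.cmDatum L 2 (Matrix.of fun i j : Fin 2 => if i.val + j.val + 1 = 2 then (1 : L) else 0)).Local v ⧸ Subgroup.center ((UnitaryGroup.cmDatum L 2 (Matrix.of fun i j : Fin 2 => if i.val + j.val + 1 = 2 then (1 : L) else 0)).Local v)), μZ.IsHaarMeasure ∧ c.IsSquareIntegrable μZ := by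
  intro L _ _ _ v ξ hns hξ₂ c hc hne
  letI : MeasurableSpace ((UnitaryGroup.cmDatum L 2 (Matrix.of fun i j : Fin 2 => if i.val + j.val + 1 = 2 then (1 : L) else 0)).Local v ⧸
      Subgroup.center ((UnitaryGroup.cmDatum L 2 (Matrix.of fun i j : Fin 2 => if i.val + j.val + 1 = 2 then (1 : L) else 0)).Local v)) := borel _
  haveI : BorelSpace ((UnitaryGroup.cmDatum L 2 (Matrix.of fun i j : Fin 2 => if i.val + j.val + 1 = 2 then (1 : L) else 0)).Local v ⧸
      Subgroup.center ((UnitaryGroup.cmDatum L 2 (Matrix.of fun i j : Fin 2 => if i.val + j.val + 1 = 2 then (1 : L) else 0)).Local v)) := ⟨rfl⟩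
  haveI : LocallyCompactSpace ((UnitaryGroup.cmDatum L 2 (Matrix.of fun i j : Fin 2 => if i.val + j.val + 1 = 2 then (1 : L) else 0)).Local v) :=
    locallyCompactSpace_local (IsCMField.complexConj L) 2 _ v
  -- the same Borel data in the `↥(unitaryGroupOfForm …)` spelling of bricks (A)∕(B)
  letI : MeasurableSpace (↥(unitaryGroupOfForm (conjLocal L (IsCMField.complexConj L) v) (cmLocalForm L 2 v)) ⧸
      Subgroup.center ↥(unitaryGroupOfForm (conjLocal L (IsCMField.complexConj L) v) (cmLocalForm L 2 v))) := borel _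
  haveI : BorelSpace (↥(unitaryGroupOfForm (conjLocal L (IsCMField.complexConj L) v) (cmLocalForm L 2 v)) ⧸
      Subgroup.center ↥(unitaryGroupOfForm (conjLocal L (IsCMField.complexConj L) v) (cmLocalForm L 2 v))) := ⟨rfl⟩
  haveI : LocallyCompactSpace ↥(unitaryGroupOfForm (conjLocal L (IsCMField.complexConj L) v) (cmLocalForm L 2 v)) :=
    locallyCompactSpace_local (IsCMField.complexConj L) 2 _ v
  -- the dictionary `ξ₂(g) = η_v(det g) · ψ_v(det g)` (★ `xiLocalChar_apply_eq`, `det₁ 1 = 1`)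
  have h1 : localDet (IsCMField.complexConj L) v (isUnit_antidiagOne_det L 1)
      (J := Matrix.of fun i j : Fin 1 => if i.val + j.val + 1 = 1 then (1 : L) else 0)
      (1 : ((cmDatum L 1 (Matrix.of fun i j : Fin 1 => if i.val + j.val + 1 = 1 then (1 : L) else 0)).Local v)) = 1 :=
    map_one _
  have hdict : ∀ g : ↥(unitaryGroupOfForm (conjLocal L (IsCMField.complexConj L) v) (cmLocalForm L 2 v)),
      ((ξ.xiLocalChar v).comp (MonoidHom.inl ((cmDatum L 2 (Matrix.of fun i j : Fin 2 => if i.val + j.val + 1 = 2 then (1 : L) else 0)).Local v)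
        ((cmDatum L 1 (Matrix.of fun i j : Fin 1 => if i.val + j.val + 1 = 1 then (1 : L) else 0)).Local v))) g =
      torusLocalComponent L (IsCMField.complexConj L) v ξ.η (localDet (IsCMField.complexConj L) v (isUnit_antidiagOne_det L 2) g) *
        torusLocalComponent L (IsCMField.complexConj L) v ξ.ψ (localDet (IsCMField.complexConj L) v (isUnit_antidiagOne_det L 2) g) := by
    intro g
    rw [MonoidHom.comp_apply, MonoidHom.inl_apply, OneDimAutRepH.xiLocalChar_apply_eq]
    change torusLocalComponent L (IsCMField.complexConj L) v ξ.η (localDet (IsCMField.complexConj L) v (isUnit_antidiagOne_det L 2) g) *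
        torusLocalComponent L (IsCMField.complexConj L) v ξ.ψ
          (localDet (IsCMField.complexConj L) v (isUnit_antidiagOne_det L 2) g *
            localDet (IsCMField.complexConj L) v (isUnit_antidiagOne_det L 1)
              (J := Matrix.of fun i j : Fin 1 => if i.val + j.val + 1 = 1 then (1 : L) else 0)
              (1 : ((cmDatum L 1 (Matrix.of fun i j : Fin 1 => if i.val + j.val + 1 = 1 then (1 : L) else 0)).Local v))) = _
    rw [h1, mul_one]
  -- brick (B): `r_{B₂}(c) ≅ χH₂`
  have hB := exists_normalizedJacquet_equiv_chiH2_of_ne_ofChar L v hns ξ _ hξ₂ hdict c hc hne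
  -- admissibility of `c`
  have hadm := R90.S4.isAdmissible_of_isConstituentOf_cmPrincipalSeries L v 2 _ hc
  -- brick (A): Casselman «⇐» with the decay of `χH₂` (§1), at Mathlib's Haar measure on the Borel quotient (bricks' spelling)
  have key := isSquareIntegrable_of_jacquet_decays_two L v hns
    (Measure.haar : Measure (↥(unitaryGroupOfForm (conjLocal L (IsCMField.complexConj L) v) (cmLocalForm L 2 v)) ⧸
      Subgroup.center ↥(unitaryGroupOfForm (conjLocal L (IsCMField.complexConj L) v) (cmLocalForm L 2 v))))
    c _ hadm hB (fun t ht => norm_chiH2_lt_one L v hns ξ t ht)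
  -- the socket's spelling `(cmDatum L 2 Φ₂).Local v` (definitionally the same group, Borel structure and Haar measure)
  exact ⟨Measure.haar, inferInstance, key⟩

end Summit.HodgeConjecture.HodgeConjecture.R90.S10

end
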